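import Summits.QuantumFields.YangMills.Theorems.BalabanUVNodesN19SingleModeL1Norm
import Mathlib.Analysis.SpecialFunctions.Log.Base

/-!
# YM-DAG node N19 (= NE7 proper) — MULTISCALE TELESCOPING, PART 2b: THE SINGLE-MODE LAW AT A PRESCRIBED DEGREE BUDGET `t` —
# `dist_∞(e^{iωΣ_{i≤d}|x_i|}, Π_t) ≤ 300·log₂t·(log₂t + 4ωd)∕t` for ALL `t ≥ 8`, `ω ≥ 0`, `d`

Cell `pub-ymgap`, HUMAN RULING D-0062 (Track A) ∕ D-0149 (work-bound push), R141 (C) wider-strategy seat `pub-ymgap-dag-n19-e` (strategy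
s3 = ALTERNATIVE CURRENCY), generation g30, module 5 (lineage module 122).  Route `Summits/QuantumFields/YangMills/Theses/BalabanUVNodes.lean`,
cluster item K3⁸ «SpineGivenEndpointR13SepCoPHV» (stmt-QuantumFields-27366); filed `--supports` that item `--as helper` (it proves no registered
stub).  COUNT-NEUTRAL: [folklore]∕[bookkeeping] over Mathlib (`Nat.findGreatest`, `Real.logb`) and PART 2 `…N19SingleModeL1Norm` BY NAME
(`exists_pair_near_cexp_l1Norm_of_le`); no laws, no scheme object, no Theses import; NOT a discharge claim.

CONTENT.  PART 2 states the single mode at the dyadic budgets `t = (J+1)2^{J+3}` under `150ωd ≤ 2^{J+2}`.  This module removes both provisos: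
§1 `exists_dyadicBudget` (for `t ≥ 8` the largest `J` with `(J+1)2^{J+3} ≤ t`; then `t < (J+2)2^{J+4}`) · `dyadicBudget_bounds` (its real
consequences `1∕2^J ≤ 16(J+2)∕t`, `J + 3 ≤ log₂t`, `t ≤ 4(J+2)·2^{J+2}`) · §2 ★★★ `exists_pair_near_cexp_l1Norm_degree`: for ALL `t ≥ 8`, `ω ≥ 0` a pair
of real `MvPolynomial`s of total degree `≤ t` with `‖Cr(x) + Ci(x)·i − e^{iωΣ_i|x_i|}‖ ≤ 300·log₂t·(log₂t + 4ωd)∕t` on `[−1,1]^ι` (if `150ωd ≤ 2^{J+2}`: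
PART 2 and the bounds of §1, constant `16`; otherwise `600ωd(J+2) > t` makes the right-hand side `≥ 2`, and the zero pair will do) ·
★★ `exists_mvPolynomial_near_cos_l1Norm_degree` ∕ `…_sin_…` (real faces).
READING (OPEN-PROBLEM.md reformulation 3, honest): `dist_∞(cos(ωS_k), Π_t) ≤ 300·log₂t·(log₂t + 4kω)∕t` for all `k, ω ≥ 0, t ≥ 8` — the
single-mode law LINEAR in `kω∕t` up to the factor `log₂t` (and the additive `log₂²t∕t`), uniformly in `k`; the conjectured `ψ(kω∕t)` would have no
`log t`.  Constants not optimised.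

HONEST FRAMING (binding).  Elementary and [folklore]; ONE-SIDED (upper bounds); NO consumer in the DAG today (an optimality map of the seat's own
currency, degree model); nothing of Bałaban's instantiated; NE7 NOT PRINTED, NOT proved; N19 NOT discharged; count-neutral.  One finite `T⁴` programme
at fixed `ε`; nothing continuum ∕ `ℝ⁴` ∕ OS ∕ mass-gap ∕ Clay.  0 `def` ∕ 0 `sorry`.
-/

noncomputable section

open Finset Complex
open scoped Real

namespace Summit.QuantumFields.YangMills.Theorems.BalabanUVNodesN19SingleModeDegreeBudget

open Summit.QuantumFields.YangMills.Theorems.BalabanUVNodesN19SingleModeL1Norm (exists_pair_near_cexp_l1Norm_of_le)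

variable {ι : Type*} [Fintype ι]

/-! ## §1 The dyadic budget below `t` [bookkeeping] -/

/-- **THE DYADIC BUDGET.**  For `t ≥ 8` there is `J` with `(J+1)2^{J+3} ≤ t < (J+2)2^{J+4}` (the largest admissible `J`). [bookkeeping] -/
theorem exists_dyadicBudget {t : ℕ} (ht : 8 ≤ t) : ∃ J : ℕ, (J + 1) * 2 ^ (J + 3) ≤ t ∧ t < (J + 2) * 2 ^ (J + 4) := by
  classical
  have hP0 : (0 + 1) * 2 ^ (0 + 3) ≤ t := by norm_num; exact ht
  refine ⟨Nat.findGreatest (fun J => (J + 1) * 2 ^ (J + 3) ≤ t) t,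
    Nat.findGreatest_spec (P := fun J => (J + 1) * 2 ^ (J + 3) ≤ t) (Nat.zero_le t) hP0, ?_⟩
  set J := Nat.findGreatest (fun J => (J + 1) * 2 ^ (J + 3) ≤ t) t with hJ
  by_contra hlt
  have hle : (J + 2) * 2 ^ (J + 4) ≤ t := not_lt.1 hlt
  have hJ1t : J + 1 ≤ t := by
    have h1 : J + 1 ≤ (J + 2) * 2 ^ (J + 4) := by
      have : 1 ≤ 2 ^ (J + 4) := Nat.one_le_two_pow
      nlinarith
    exact h1.trans hle
  have hnot := Nat.findGreatest_is_greatest (P := fun J => (J + 1) * 2 ^ (J + 3) ≤ t) (Nat.lt_succ_self J) hJ1t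
  exact hnot hle

/-- The real consequences of the dyadic budget: `1∕2^J ≤ 16(J+2)∕t`, `J + 3 ≤ log₂t`, `t ≤ 4(J+2)·2^{J+2}`, `3 ≤ log₂t`. [bookkeeping] -/
theorem dyadicBudget_bounds {t J : ℕ} (h1 : (J + 1) * 2 ^ (J + 3) ≤ t) (h2 : t < (J + 2) * 2 ^ (J + 4)) :
    (1 : ℝ) / 2 ^ J ≤ 16 * ((J : ℝ) + 2) / t ∧ (J : ℝ) + 3 ≤ Real.logb 2 t ∧ (t : ℝ) ≤ 4 * ((J : ℝ) + 2) * 2 ^ (J + 2) ∧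
      (3 : ℝ) ≤ Real.logb 2 t := by
  have h1r : ((J : ℝ) + 1) * 2 ^ (J + 3) ≤ t := by exact_mod_cast h1
  have h2r : (t : ℝ) < ((J : ℝ) + 2) * 2 ^ (J + 4) := by exact_mod_cast h2
  have h2J : (0 : ℝ) < 2 ^ J := by positivity
  have ht0 : (0 : ℝ) < t := lt_of_lt_of_le (by positivity) h1r
  have hpow : (2 : ℝ) ^ (J + 3) ≤ t := by
    have : (1 : ℝ) * 2 ^ (J + 3) ≤ ((J : ℝ) + 1) * 2 ^ (J + 3) :=
      mul_le_mul_of_nonneg_right (by linarith [(Nat.cast_nonneg J : (0 : ℝ) ≤ J)]) (by positivity)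
    linarith
  have hlog : (J : ℝ) + 3 ≤ Real.logb 2 t := by
    rw [Real.le_logb_iff_rpow_le one_lt_two ht0]
    have e : (2 : ℝ) ^ ((J : ℝ) + 3) = 2 ^ (J + 3) := by
      rw [← Real.rpow_natCast]; push_cast; ring_nf
    rw [e]; exact hpow
  refine ⟨?_, hlog, ?_, ?_⟩
  · rw [div_le_div_iff₀ h2J ht0]
    have e : ((J : ℝ) + 2) * 2 ^ (J + 4) = 16 * ((J : ℝ) + 2) * 2 ^ J := by ring
    linarith
  · have e : ((J : ℝ) + 2) * 2 ^ (J + 4) = 4 * ((J : ℝ) + 2) * 2 ^ (J + 2) := by ring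
    linarith
  · linarith [(Nat.cast_nonneg J : (0 : ℝ) ≤ J)]

/-! ## §2 ★★★ The single mode at every degree budget [folklore] -/

/-- ★★★ **THE SINGLE-MODE LAW AT DEGREE `t`.**  For all `t ≥ 8`, `ω ≥ 0` there is a pair of real `MvPolynomial`s `(Cr, Ci)` of total degree `≤ t`
with `‖Cr(x) + Ci(x)·i − e^{iωΣ_i|x_i|}‖ ≤ 300·log₂t·(log₂t + 4ωd)∕t` on `[−1,1]^ι` (`d = |ι|`).  With the dyadic `J` of §1: if `150ωd ≤ 2^{J+2}`,
PART 2's pair of degree `≤ (J+1)2^{J+3} ≤ t` has error `≤ (J+1+4ωd)∕2^J ≤ 16(J+2)(J+1+4ωd)∕t ≤ 16log₂t(log₂t + 4ωd)∕t`; otherwise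
`t ≤ 4(J+2)2^{J+2} < 600(J+2)ωd` forces `300log₂t·4ωd∕t ≥ 2`, met by the zero pair. [folklore] -/
theorem exists_pair_near_cexp_l1Norm_degree {t : ℕ} (ht : 8 ≤ t) {ω : ℝ} (hω : 0 ≤ ω) :
    ∃ Cr Ci : MvPolynomial ι ℝ, Cr.totalDegree ≤ t ∧ Ci.totalDegree ≤ t ∧
      ∀ x : ι → ℝ, (∀ i, x i ∈ Set.Icc (-1 : ℝ) 1) →
        ‖((MvPolynomial.eval x Cr : ℝ) : ℂ) + ((MvPolynomial.eval x Ci : ℝ) : ℂ) * I - exp (((ω * ∑ i, |x i| : ℝ) : ℂ) * I)‖ ≤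
          300 * Real.logb 2 t * (Real.logb 2 t + 4 * ω * Fintype.card ι) / t := by
  set d : ℝ := (Fintype.card ι : ℝ) with hd
  have hd0 : 0 ≤ d := Nat.cast_nonneg _
  obtain ⟨J, h1, h2⟩ := exists_dyadicBudget ht
  obtain ⟨hinv, hlog, htle, hlog3⟩ := dyadicBudget_bounds h1 h2
  set L : ℝ := Real.logb 2 t with hL
  have ht0 : (0 : ℝ) < t := by exact_mod_cast lt_of_lt_of_le (by norm_num) ht
  have hJ0 : (0 : ℝ) ≤ J := Nat.cast_nonneg _
  have hωd : 0 ≤ ω * d := mul_nonneg hω hd0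
  by_cases hcase : 150 * ω * d ≤ 2 ^ (J + 2)
  · obtain ⟨Cr, Ci, hCr, hCi, happ⟩ := exists_pair_near_cexp_l1Norm_of_le (ι := ι) hω hcase
    refine ⟨Cr, Ci, hCr.trans h1, hCi.trans h1, fun x hx => (happ x hx).trans ?_⟩
    have h2J : (0 : ℝ) < 2 ^ J := by positivity
    -- `(J+1+4ωd)/2^J ≤ 16(J+2)(J+1+4ωd)/t ≤ 16 L (L + 4ωd)/t ≤ 300 L (L+4ωd)/t`
    have hnum : 0 ≤ (J : ℝ) + 1 + 4 * ω * d := by nlinarith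
    calc ((J : ℝ) + 1 + 4 * ω * d) / 2 ^ J = ((J : ℝ) + 1 + 4 * ω * d) * (1 / 2 ^ J) := by ring
      _ ≤ ((J : ℝ) + 1 + 4 * ω * d) * (16 * ((J : ℝ) + 2) / t) := mul_le_mul_of_nonneg_left hinv hnum
      _ ≤ (L + 4 * ω * d) * (16 * L / t) := by
          refine mul_le_mul (by linarith) ?_ (by positivity) (by linarith)
          exact div_le_div_of_nonneg_right (by linarith) ht0.le
      _ = 16 * L * (L + 4 * ω * d) / t := by ring
      _ ≤ 300 * L * (L + 4 * ω * d) / t := by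
          refine div_le_div_of_nonneg_right ?_ ht0.le
          nlinarith
  · refine ⟨0, 0, by simp, by simp, fun x hx => ?_⟩
    rw [map_zero, Complex.ofReal_zero, zero_mul, zero_add, zero_sub, norm_neg, Complex.norm_exp_ofReal_mul_I]
    -- `600 ω d (J+2) > t` ⇒ `300 L · 4ωd / t ≥ 2`
    have hlt : (2 : ℝ) ^ (J + 2) < 150 * ω * d := lt_of_not_ge hcase
    have hbig : (t : ℝ) < 600 * ((J : ℝ) + 2) * (ω * d) := by nlinarith
    rw [le_div_iff₀ ht0]
    nlinarith [mul_nonneg (by norm_num : (0 : ℝ) ≤ 300) (mul_nonneg (by linarith : (0 : ℝ) ≤ L) (by linarith : (0 : ℝ) ≤ L)),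
      mul_le_mul_of_nonneg_right (by linarith : (J : ℝ) + 2 ≤ L) hωd]

/-- ★★ **REAL FACE AT DEGREE `t`: `dist_∞(cos(ωS_d), Π_t) ≤ 300·log₂t·(log₂t + 4ωd)∕t`** for all `t ≥ 8`, `ω ≥ 0`, `d` (`S_d = Σ_{i≤d}|x_i|` on
`[−1,1]^d`).  OPEN-PROBLEM.md reformulation 3 asked for `ψ(dω∕t)`; this is `C·(dω∕t)·log₂t + C·log₂²t∕t`. [folklore] -/
theorem exists_mvPolynomial_near_cos_l1Norm_degree {t : ℕ} (ht : 8 ≤ t) {ω : ℝ} (hω : 0 ≤ ω) :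
    ∃ P : MvPolynomial ι ℝ, P.totalDegree ≤ t ∧
      ∀ x : ι → ℝ, (∀ i, x i ∈ Set.Icc (-1 : ℝ) 1) →
        |Real.cos (ω * ∑ i, |x i|) - MvPolynomial.eval x P| ≤ 300 * Real.logb 2 t * (Real.logb 2 t + 4 * ω * Fintype.card ι) / t := by
  obtain ⟨Cr, Ci, hCr, -, happ⟩ := exists_pair_near_cexp_l1Norm_degree (ι := ι) ht hω
  refine ⟨Cr, hCr, fun x hx => ?_⟩
  have hre : (((MvPolynomial.eval x Cr : ℝ) : ℂ) + ((MvPolynomial.eval x Ci : ℝ) : ℂ) * I -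
          exp (((ω * ∑ i, |x i| : ℝ) : ℂ) * I)).re = MvPolynomial.eval x Cr - Real.cos (ω * ∑ i, |x i|) := by
    simp only [Complex.sub_re, Complex.add_re, Complex.mul_re, Complex.ofReal_re, Complex.ofReal_im, Complex.I_re,
      Complex.I_im, Complex.exp_ofReal_mul_I_re]
    ring
  rw [abs_sub_comm, ← hre]
  exact (Complex.abs_re_le_norm _).trans (happ x hx)

/-- ★★ **REAL FACE AT DEGREE `t`: `dist_∞(sin(ωS_d), Π_t) ≤ 300·log₂t·(log₂t + 4ωd)∕t`** for all `t ≥ 8`, `ω ≥ 0`, `d`. [folklore] -/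
theorem exists_mvPolynomial_near_sin_l1Norm_degree {t : ℕ} (ht : 8 ≤ t) {ω : ℝ} (hω : 0 ≤ ω) :
    ∃ P : MvPolynomial ι ℝ, P.totalDegree ≤ t ∧
      ∀ x : ι → ℝ, (∀ i, x i ∈ Set.Icc (-1 : ℝ) 1) →
        |Real.sin (ω * ∑ i, |x i|) - MvPolynomial.eval x P| ≤ 300 * Real.logb 2 t * (Real.logb 2 t + 4 * ω * Fintype.card ι) / t := by
  obtain ⟨Cr, Ci, -, hCi, happ⟩ := exists_pair_near_cexp_l1Norm_degree (ι := ι) ht hω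
  refine ⟨Ci, hCi, fun x hx => ?_⟩
  have him : (((MvPolynomial.eval x Cr : ℝ) : ℂ) + ((MvPolynomial.eval x Ci : ℝ) : ℂ) * I -
          exp (((ω * ∑ i, |x i| : ℝ) : ℂ) * I)).im = MvPolynomial.eval x Ci - Real.sin (ω * ∑ i, |x i|) := by
    simp only [Complex.sub_im, Complex.add_im, Complex.mul_im, Complex.ofReal_re, Complex.ofReal_im, Complex.I_re,
      Complex.I_im, Complex.exp_ofReal_mul_I_im]
    ring
  rw [abs_sub_comm, ← him]
  exact (Complex.abs_im_le_norm _).trans (happ x hx)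

end Summit.QuantumFields.YangMills.Theorems.BalabanUVNodesN19SingleModeDegreeBudget

end
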